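import Literature.Computability.QuantumComplexity.KeyedOracleRun
import Literature.Computability.QuantumComplexity.CoinFamilyKernel
import HarnessLib

/-!
# The KEYED-ORACLE FAMILY: one uniform-shape circuit per input length running an oracle algorithm on a keyed oracle

Topic `Literature/Computability/QuantumComplexity`; the FAMILY-level packaging of `KeyedOracleRun.lean` (inside one
circuit: Hadamards on `κ` key wires, then the oracle algorithm with every query PREFIXED by a classical register; the
event probabilities are the key-averages of those of the algorithm relative to the sliced oracles `A⟨c⟩`,
`sum_normSq_hadamards_retarget_eq_avg_event`). Given an oracle algorithm `F` (a `QCircuitFamily` WITH oracle gates)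
and two size functions `nOf, κOf : ℕ → ℕ` (`nOf L ≤ L`), the family `KeyedRun.family` acts on an input `z` of
length `L` as follows: the first `n = nOf L` symbols of `z` are the INPUT `x` of `F`, the remaining `L − n` symbols
`r = z.drop n` are a classical PARAMETER, `κ = κOf L` ancilla wires carry a uniformly random KEY (Hadamards), and
`F.circ n` is run (its ancillas on fresh wires) with every oracle query `u` replaced by the query `r ++ key ++ u`
(`OracleRetarget.retarget` with prefix wires = parameter wires then key wires). This is the circuit form of "choose a
random member `h_key` of a hash family and run the algorithm with oracle access to `h_key`, the instance written next
to the key" (Zhandry 2012, Thm. 3.1; Bennett–Bernstein–Brassard–Vazirani 1997, §4: oracle machines as subroutines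
with part of the query fixed), at the level of the tree's uniform families (`QCircuitFamily.kernelProb`).

* the structure `KeyedRun` (`F`, `nOf`, `κOf`, `nOf_le`); the wire maps `emb` (wires of `F.circ n`: input wire `i < n` ↦
  `i`, ancilla `n + j` ↦ `L + j`), `pre` (prefix: parameter wire `a < L − n` ↦ `n + a`, key wire `j` ↦
  `L + m_F + j`), `keyT`; `pre_ne_emb`; **`KeyedRun.family`**;
* `inp P z` — the input register `x = z[0 .. n)` of `F`; `ofFn_prefixContent` — the prefix content on the branch of
  `key` is `z.drop n ++ key`;
* **`KeyedRun.kernelProb_family_eq_avg_probEvent`** — for every oracle `A`, input `z` and event `T` on the register of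
  `F.circ n` read through `emb`:
  `family.kernelProb A z {s | T (i ↦ s[emb i])} = 2^{-κ} Σ_key probEvent_{A⟨z.drop n ++ key⟩}(F.circ n on |x 0^{m_F}⟩, T)`;
* **`KeyedRun.acceptProbOn_family_eq_avg`** — for `n ≥ 1` (so that wire `0` is `F`'s answer wire):
  `family.acceptProbOn A z = 2^{-κ} Σ_key acceptProb_{A⟨z.drop n ++ key⟩}(F.circ n, x)`;
* `QCircuitFamily.probEvent_ofFn_eq_kernelProb` — bridge to `F.kernelProb` for inputs `x` with `|x| = n`;
* `family_oracleQueries` — the circuit on length `L` makes exactly the queries of `F.circ (nOf L)` (the error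
  budget of a later oracle substitution, BBBV 1997, Thm. 4.14).

Everything here is PROVED; the definitions are explicit (a structure of parameters, three wire embeddings, the family,
the input register). Uniformity of the family (for uniform `F` and size functions computed in polynomial time) is the
business of a sequel.

## References

* M. Zhandry, *Secure identity-based encryption in the quantum random oracle model*, CRYPTO 2012 (arXiv:1204.0629),
  Thm. 3.1 (a `2T`-wise independent family simulates a random oracle; the simulator runs the algorithm on a random
  member) [Zhandry2012].
* C. H. Bennett, E. Bernstein, G. Brassard, U. Vazirani, *Strengths and weaknesses of quantum computing*, SIAM J.
  Comput. 26 (1997) 1510–1523, §4 (oracle subroutines), Thm. 4.14 [BennettBernsteinBrassardVazirani1997].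
* M. A. Nielsen, I. L. Chuang, *Quantum Computation and Quantum Information*, CUP 2010, §4.4 (deferred measurement),
  §6.1.1 (the XOR oracle), §2.2.8 [NielsenChuang2010].
-/

noncomputable section

namespace Literature.Computability.QuantumComplexity

open Cryptography Matrix Finset

/-- **Parameters of a keyed run**: the oracle algorithm `F`, the input length `nOf L ≤ L` of `F` and the number of
key wires `κOf L`, both read off the instance length `L`. [cite: Zhandry2012, Thm. 3.1] -/
structure KeyedRun where
  /-- The oracle algorithm (a family with oracle gates). -/
  F : QCircuitFamily cliffordT
  /-- The input length of `F` on instances of length `L`. -/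
  nOf : ℕ → ℕ
  /-- The number of key wires on instances of length `L`. -/
  κOf : ℕ → ℕ
  /-- The input of `F` is a prefix of the instance. -/
  nOf_le : ∀ L, nOf L ≤ L

namespace KeyedRun

variable (P : KeyedRun)

/-- The number of ancillas of `F` on instances of length `L`. [cite: Zhandry2012, Thm. 3.1] -/
abbrev mF (L : ℕ) : ℕ := P.F.ancillas (P.nOf L)

/-- The ancillas of the keyed family: those of `F`, then the key wires. [cite: Zhandry2012, Thm. 3.1] -/
abbrev anc (L : ℕ) : ℕ := P.mF L + P.κOf L

/-! ### Wire maps -/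

/-- **The wires of `F.circ n` inside the big register**: input wire `i < n` ↦ `i` (where the instance holds `x`),
ancilla wire `n + j` ↦ `L + j`. [cite: BennettBernsteinBrassardVazirani1997, §4 (a subroutine on its own wires)] -/
def emb (L : ℕ) : Fin (P.nOf L + P.mF L) ↪ Fin (L + P.anc L) where
  toFun i := ⟨if (i : ℕ) < P.nOf L then (i : ℕ) else L + ((i : ℕ) - P.nOf L), by
    have := i.2; have := P.nOf_le L; show _ < L + (P.mF L + P.κOf L); split_ifs <;> omega⟩
  inj' i j h := by
    have hi := i.2; have hj := j.2; have := P.nOf_le L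
    simp only [Fin.mk.injEq] at h
    apply Fin.ext
    split_ifs at h <;> omega

/-- Value of `emb`. [cite: NielsenChuang2010, §4.3 (placing a gate on chosen wires)] -/
theorem emb_val (L : ℕ) (i : Fin (P.nOf L + P.mF L)) :
    ((P.emb L i : Fin (L + P.anc L)) : ℕ) = if (i : ℕ) < P.nOf L then (i : ℕ) else L + ((i : ℕ) - P.nOf L) := rfl

/-- **The prefix wires**: parameter wire `a < L − n` ↦ `n + a` (the rest of the instance), key wire `j` ↦
`L + m_F + j`. [cite: Zhandry2012, Thm. 3.1 (the key)] [cite: NielsenChuang2010, §6.1.1] -/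
def pre (L : ℕ) : Fin ((L - P.nOf L) + P.κOf L) ↪ Fin (L + P.anc L) where
  toFun a := ⟨if (a : ℕ) < L - P.nOf L then P.nOf L + (a : ℕ) else L + P.mF L + ((a : ℕ) - (L - P.nOf L)), by
    have := a.2; have := P.nOf_le L; show _ < L + (P.mF L + P.κOf L); split_ifs <;> omega⟩
  inj' a b h := by
    have ha := a.2; have hb := b.2; have := P.nOf_le L
    simp only [Fin.mk.injEq] at h
    apply Fin.ext
    split_ifs at h <;> omega

/-- Value of `pre`. [cite: NielsenChuang2010, §4.3 (placing a gate on chosen wires)] -/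
theorem pre_val (L : ℕ) (a : Fin ((L - P.nOf L) + P.κOf L)) :
    ((P.pre L a : Fin (L + P.anc L)) : ℕ) =
      if (a : ℕ) < L - P.nOf L then P.nOf L + (a : ℕ) else L + P.mF L + ((a : ℕ) - (L - P.nOf L)) := rfl

/-- **The key wires among the prefix wires** (the last `κ`). [cite: Zhandry2012, Thm. 3.1] -/
def keyT (L : ℕ) : Fin (P.κOf L) ↪ Fin ((L - P.nOf L) + P.κOf L) where
  toFun j := Fin.natAdd (L - P.nOf L) j
  inj' i j h := by simpa using h

/-- Value of `keyT`. [cite: NielsenChuang2010, §4.3] -/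
theorem keyT_val (L : ℕ) (j : Fin (P.κOf L)) : ((P.keyT L j : Fin ((L - P.nOf L) + P.κOf L)) : ℕ) = (L - P.nOf L) + j :=
  rfl

/-- Value of a key wire in the big register: `L + m_F + j`. [cite: NielsenChuang2010, §4.3] -/
theorem keyT_trans_pre_val (L : ℕ) (j : Fin (P.κOf L)) :
    ((((P.keyT L).trans (P.pre L)) j : Fin (L + P.anc L)) : ℕ) = L + P.mF L + (j : ℕ) := by
  rw [Function.Embedding.trans_apply, pre_val, keyT_val]
  rw [if_neg (by omega)]
  simp

/-- The prefix wires and the wires of `F.circ n` are disjoint. [cite: NielsenChuang2010, §4.3] -/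
theorem pre_ne_emb (L : ℕ) : ∀ a i, P.pre L a ≠ P.emb L i := by
  intro a i h
  have hv := congrArg Fin.val h
  rw [pre_val, emb_val] at hv
  have := a.2; have := i.2; have := P.nOf_le L
  split_ifs at hv <;> omega

/-! ### The family -/

/-- **The keyed-oracle circuit on instances of length `L`**: Hadamards on the key wires, then `F.circ (nOf L)` with
its oracle gates re-targeted to the prefix (parameter wires, then key wires).
[cite: Zhandry2012, Thm. 3.1] [cite: BennettBernsteinBrassardVazirani1997, §4] -/
def circ (L : ℕ) : QCircuit cliffordT (L + P.anc L) :=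
  ⟨(List.ofFn ((P.keyT L).trans (P.pre L))).map hOn ++
    retarget (P.pre L) (P.emb L) (P.pre_ne_emb L) (P.F.circ (P.nOf L)).gates⟩

/-- **The keyed-oracle family.** [cite: Zhandry2012, Thm. 3.1] [cite: BennettBernsteinBrassardVazirani1997, §4] -/
def family : QCircuitFamily cliffordT where
  ancillas := P.anc
  circ := P.circ

/-- The family's circuits unfold. [cite: Zhandry2012, Thm. 3.1] -/
@[simp] theorem family_circ (L : ℕ) : P.family.circ L = P.circ L := rfl

/-- The family's ancillas unfold. [cite: Zhandry2012, Thm. 3.1] -/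
@[simp] theorem family_ancillas (L : ℕ) : P.family.ancillas L = P.anc L := rfl

/-- The gates of the keyed circuit. [cite: Zhandry2012, Thm. 3.1] -/
theorem circ_gates (L : ℕ) : (P.circ L).gates = (List.ofFn ((P.keyT L).trans (P.pre L))).map hOn ++
    retarget (P.pre L) (P.emb L) (P.pre_ne_emb L) (P.F.circ (P.nOf L)).gates := rfl

/-- **The keyed circuit makes exactly the queries of `F.circ (nOf L)`.**
[cite: BennettBernsteinBrassardVazirani1997, Thm. 4.14 (the number of subroutine calls)] -/
theorem family_oracleQueries (L : ℕ) :
    (P.family.circ L).oracleQueries = (P.F.circ (P.nOf L)).oracleQueries := by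
  rw [← oracleQueries_retarget (P.pre L) (P.emb L) (P.pre_ne_emb L) (P.F.circ (P.nOf L)).gates]
  show ((P.circ L).gates.filter fun g => ¬ g.IsOracleFree).length = _
  rw [circ_gates, List.filter_append, List.length_append]
  have h0 : ((List.map hOn (List.ofFn ((P.keyT L).trans (P.pre L)))).filter
      fun g => ¬ g.IsOracleFree).length = 0 := by
    rw [List.length_eq_zero_iff, List.filter_eq_nil_iff]
    intro g hg
    obtain ⟨i, -, rfl⟩ := List.mem_map.1 hg
    simp [hOn, QGate.IsOracleFree]
  rw [h0, Nat.zero_add]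
  rfl

/-! ### The input register and the prefix content -/

/-- **The input register of `F`**: the first `n = nOf |z|` symbols of the instance. [cite: Zhandry2012, Thm. 3.1] -/
def inp (z : List Bool) : QReg (P.nOf z.length) :=
  fun i => z.get ⟨i, lt_of_lt_of_le i.2 (P.nOf_le z.length)⟩

/-- Values of a padded input. [folklore] -/
private theorem padInput_val {n M : ℕ} (x : QReg n) (i : Fin (n + M)) :
    padInput x M i = if h : (i : ℕ) < n then x ⟨i, h⟩ else false := by
  unfold padInput
  by_cases h : (i : ℕ) < n
  · rw [dif_pos h]
    have : i = Fin.castAdd M ⟨i, h⟩ := Fin.ext rfl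
    conv_lhs => rw [this]
    exact Fin.append_left _ _ _
  · rw [dif_neg h]
    obtain ⟨j, rfl⟩ : ∃ j : Fin M, i = Fin.natAdd n j := ⟨⟨(i : ℕ) - n, by omega⟩, Fin.ext (by simp; omega)⟩
    exact Fin.append_right _ _ _

/-- The big basis input restricted to the wires of `F.circ n` is `|x 0^{m_F}⟩`. [cite: NielsenChuang2010, §4.3] -/
theorem padInput_comp_emb (z : List Bool) :
    padInput z.get (P.anc z.length) ∘ P.emb z.length = padInput (P.inp z) (P.mF z.length) := by
  funext i
  simp only [Function.comp_apply]
  rw [padInput_val, padInput_val]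
  by_cases hi : (i : ℕ) < P.nOf z.length
  · have hlt : ((P.emb z.length i : Fin (z.length + P.anc z.length)) : ℕ) < z.length := by
      rw [emb_val, if_pos hi]; exact lt_of_lt_of_le hi (P.nOf_le z.length)
    rw [dif_pos hlt, dif_pos hi]
    simp only [inp, List.get_eq_getElem]
    congr 1
    rw [emb_val, if_pos hi]
  · have hge : ¬ ((P.emb z.length i : Fin (z.length + P.anc z.length)) : ℕ) < z.length := by
      rw [emb_val, if_neg hi]; omega
    rw [dif_neg hge, dif_neg hi]

/-- The big basis input reads `0` on the key wires. [cite: NielsenChuang2010, §1.4.4] -/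
theorem padInput_keyWire (z : List Bool) (j : Fin (P.κOf z.length)) :
    padInput z.get (P.anc z.length) (((P.keyT z.length).trans (P.pre z.length)) j) = false := by
  rw [padInput_val, dif_neg]
  rw [keyT_trans_pre_val]
  omega

/-- The list of the entries of `z` from position `n ≤ |z|` on is `z.drop n`. [folklore] -/
private theorem ofFn_get_add_eq_drop (z : List Bool) {n : ℕ} (hn : n ≤ z.length) :
    (List.ofFn fun a : Fin (z.length - n) => z.get ⟨n + (a : ℕ), by omega⟩) = z.drop n := by
  apply List.ext_getElem
  · simp
  · intro i h1 h2
    simp [List.getElem_drop]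

/-- A parameter wire is not a key wire. [cite: NielsenChuang2010, §4.3] -/
theorem pre_castLE_not_mem_range (L : ℕ) (a : Fin (L - P.nOf L)) :
    (P.pre L) (Fin.castLE (Nat.le_add_right _ _) a) ∉ Set.range ((P.keyT L).trans (P.pre L)) := by
  rintro ⟨j, hj⟩
  have hv := congrArg Fin.val hj
  rw [keyT_trans_pre_val, pre_val] at hv
  have := a.2; have := P.nOf_le L
  simp only [Fin.val_castLE] at hv
  split_ifs at hv
  all_goals omega

/-- **The prefix content on the branch of `key`** is `z.drop n ++ key`: the parameter wires hold the rest of the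
instance, the key wires hold the key. [cite: Zhandry2012, Thm. 3.1] [cite: NielsenChuang2010, §4.4] -/
theorem ofFn_prefixContent (z : List Bool) (key : QReg (P.κOf z.length)) :
    List.ofFn (assignKey ((P.keyT z.length).trans (P.pre z.length)) (padInput z.get (P.anc z.length)) key ∘
      P.pre z.length) = z.drop (P.nOf z.length) ++ List.ofFn key := by
  rw [List.ofFn_add, ← ofFn_get_add_eq_drop z (P.nOf_le z.length)]
  congr 1
  · apply List.ofFn_inj.2
    funext a
    simp only [Function.comp_apply]
    rw [assignKey_of_not_mem_range _ _ _ (P.pre_castLE_not_mem_range z.length a), padInput_val]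
    have hlt : ((P.pre z.length (Fin.castLE (Nat.le_add_right _ _) a) : Fin (z.length + P.anc z.length)) : ℕ) <
        z.length := by
      rw [pre_val]; simp only [Fin.val_castLE]; rw [if_pos a.2]; have := a.2; omega
    rw [dif_pos hlt]
    simp only [List.get_eq_getElem]
    congr 1
    rw [pre_val]; simp only [Fin.val_castLE]; rw [if_pos a.2]
  · apply List.ofFn_inj.2
    funext j
    simp only [Function.comp_apply]
    have h := congrFun (assignKey_comp ((P.keyT z.length).trans (P.pre z.length))
      (padInput z.get (P.anc z.length)) key) j
    simp only [Function.comp_apply, Function.Embedding.trans_apply] at h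
    exact h

/-! ### The key-average identities at family level -/

/-- Reading a position of `List.ofFn y` inside the range. [folklore] -/
private theorem getD_ofFn' {W : ℕ} (y : QReg W) (i : Fin W) : (List.ofFn y).getD (i : ℕ) false = y i := by
  rw [List.getD_eq_getElem?_getD, List.getElem?_ofFn, dif_pos i.2, Option.getD_some]

/-- **The key-average identity for the keyed family (all-wires kernel, arbitrary event).** For every oracle `A`,
instance `z` (input `x = z[0..n)`, parameter `z.drop n`, `n = nOf |z|`) and event `T` on the register of `F.circ n`
read through `emb`: the probability that the measured string `s` of the keyed family satisfies `T (i ↦ s[emb i])` is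
`2^{-κ} Σ_{key ∈ {0,1}^κ} probEvent_{A⟨z.drop n ++ key⟩}(F.circ n run on |x 0^{m_F}⟩, {u | T u})`.
[cite: Zhandry2012, Thm. 3.1 (run the algorithm on h_key for a random key)] [cite: NielsenChuang2010, §4.4, §2.2.8] -/
theorem kernelProb_family_eq_avg_probEvent (A : Language Bool) (z : List Bool)
    (T : QReg (P.nOf z.length + P.mF z.length) → Prop) [DecidablePred T] :
    P.family.kernelProb A z {s | T fun i => s.getD ((P.emb z.length i : Fin (z.length + P.anc z.length)) : ℕ) false} =
      (1 / 2 : ℝ) ^ P.κOf z.length * ∑ key : QReg (P.κOf z.length),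
        (P.F.circ (P.nOf z.length)).probEvent (prefixSlice A (z.drop (P.nOf z.length) ++ List.ofFn key))
          (basisState (padInput (P.inp z) (P.mF z.length))) {u | T u} := by
  classical
  have hk : P.family.kernelProb A z
      {s | T fun i => s.getD ((P.emb z.length i : Fin (z.length + P.anc z.length)) : ℕ) false} =
      ∑ y : QReg (z.length + P.anc z.length),
        if List.ofFn y ∈ {s : List Bool | T fun i => s.getD ((P.emb z.length i : Fin (z.length + P.anc z.length)) : ℕ) false}
        then ‖(P.circ z.length).runOn A (basisState (padInput z.get (P.anc z.length))) y‖ ^ 2 else 0 :=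
    toReal_outputPMF_map_ofFn (P.circ z.length) z.get _
  rw [hk]
  have hev : ∀ y : QReg (z.length + P.anc z.length),
      (List.ofFn y ∈ {s : List Bool | T fun i => s.getD ((P.emb z.length i : Fin (z.length + P.anc z.length)) : ℕ) false}) ↔
        T (y ∘ P.emb z.length) := by
    intro y
    simp only [Set.mem_setOf_eq, getD_ofFn', Function.comp_def]
  simp_rw [hev]
  rw [← Finset.sum_filter]
  have hmain := sum_normSq_hadamards_retarget_eq_avg_event (P.F.circ (P.nOf z.length)).gates (P.pre z.length)
    (P.emb z.length) (P.pre_ne_emb z.length) (P.keyT z.length) A (padInput z.get (P.anc z.length)) (P.inp z)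
    (P.padInput_comp_emb z) (P.padInput_keyWire z) T
  rw [← circ] at hmain
  unfold QCircuit.runOn
  rw [hmain]
  congr 1
  refine Finset.sum_congr rfl fun key _ => ?_
  rw [ofFn_prefixContent, sum_ite_normSq_toMatrix_eq_probEvent]

/-- For `n ≥ 1`, wire `0` of the big register is the answer wire of `F.circ n`. [cite: BennettBernsteinBrassardVazirani1997, §4 (the subroutine's answer wire)] -/
theorem emb_zero (L : ℕ) (hn : 0 < P.nOf L) :
    P.emb L ⟨0, by omega⟩ = ⟨0, by have := P.nOf_le L; omega⟩ := Fin.ext (by rw [emb_val, if_pos hn])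

/-- **The key-average identity for the acceptance probability of the keyed family**: for `nOf |z| ≥ 1`,
`family.acceptProbOn A z = 2^{-κ} Σ_key acceptProb_{A⟨z.drop n ++ key⟩}(F.circ n, x)`.
[cite: Zhandry2012, Thm. 3.1] [cite: BennettBernsteinBrassardVazirani1997, §4] -/
theorem acceptProbOn_family_eq_avg (A : Language Bool) (z : List Bool) (hn : 0 < P.nOf z.length) :
    P.family.acceptProbOn A z =
      (1 / 2 : ℝ) ^ P.κOf z.length * ∑ key : QReg (P.κOf z.length),
        (P.F.circ (P.nOf z.length)).acceptProb (prefixSlice A (z.drop (P.nOf z.length) ++ List.ofFn key)) (P.inp z) := by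
  classical
  have h0 : 0 < z.length + P.anc z.length := by have := P.nOf_le z.length; omega
  have h0' : 0 < P.nOf z.length + P.mF z.length := by omega
  have hacc : P.family.acceptProbOn A z = (P.circ z.length).acceptProb A z.get := rfl
  rw [hacc, acceptProb_eq_sum_ite A (P.circ z.length) z.get h0, ← Finset.sum_filter]
  have hev : ∀ y : QReg (z.length + P.anc z.length),
      (y ⟨0, h0⟩ = true) ↔ (fun u : QReg (P.nOf z.length + P.mF z.length) => u ⟨0, h0'⟩ = true) (y ∘ P.emb z.length) := by
    intro y; simp only [Function.comp_apply, emb_zero P z.length hn]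
  have hfilter : univ.filter (fun y : QReg (z.length + P.anc z.length) => y ⟨0, h0⟩ = true) =
      univ.filter (fun y => (fun u : QReg (P.nOf z.length + P.mF z.length) => u ⟨0, h0'⟩ = true) (y ∘ P.emb z.length)) :=
    Finset.filter_congr fun y _ => hev y
  have hentry : ∀ y : QReg (z.length + P.anc z.length),
      ‖(P.circ z.length).toMatrix A y (padInput z.get (P.anc z.length))‖ ^ 2 =
        ‖((P.circ z.length).toMatrix A *ᵥ basisState (padInput z.get (P.anc z.length))) y‖ ^ 2 := by
    intro y; rw [mulVec_basisState]
  simp_rw [hentry]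
  have hmain := sum_normSq_hadamards_retarget_eq_avg_event (P.F.circ (P.nOf z.length)).gates (P.pre z.length)
    (P.emb z.length) (P.pre_ne_emb z.length) (P.keyT z.length) A (padInput z.get (P.anc z.length)) (P.inp z)
    (P.padInput_comp_emb z) (P.padInput_keyWire z) (fun u : QReg (P.nOf z.length + P.mF z.length) => u ⟨0, h0'⟩ = true)
  rw [← circ] at hmain
  rw [hfilter, hmain]
  congr 1
  refine Finset.sum_congr rfl fun key _ => ?_
  rw [ofFn_prefixContent, acceptProb_eq_sum_ite _ _ _ h0']

end KeyedRun

/-! ### Bridge to `F.kernelProb` -/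

/-- **The event probability on `|x 0^m⟩` is the kernel probability of the family** (for an input `x` of length
`n`, the register `x` read as `QReg n`). [cite: NielsenChuang2010, §2.2.5] -/
theorem _root_.Literature.Computability.Cryptography.QCircuitFamily.probEvent_ofFn_eq_kernelProb
    (F : QCircuitFamily cliffordT) (B : Language Bool) {n : ℕ} (x : List Bool) (hx : x.length = n)
    (E : Set (List Bool)) [DecidablePred (· ∈ E)] :
    (F.circ n).probEvent B (basisState (padInput (fun i : Fin n => x.get (Fin.cast hx.symm i)) (F.ancillas n)))
        {u | List.ofFn u ∈ E} = F.kernelProb B x E := by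
  classical
  subst hx
  have hk : F.kernelProb B x E = ∑ u : QReg (x.length + F.ancillas x.length),
      if List.ofFn u ∈ E then ‖(F.circ x.length).runOn B (basisState (padInput x.get (F.ancillas x.length))) u‖ ^ 2
      else 0 :=
    toReal_outputPMF_map_ofFn (F.circ x.length) x.get E
  rw [hk]
  unfold QCircuit.probEvent
  rw [Finset.sum_filter]
  refine Finset.sum_congr rfl fun u _ => ?_
  have hx' : (fun i : Fin x.length => x.get (Fin.cast rfl i)) = x.get := funext fun i => rfl
  simp only [Set.mem_setOf_eq, hx']

namespace KeyedRun

variable (P : KeyedRun)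

/-- The input register of an instance `x ++ r` with `nOf |x ++ r| = |x|` is `x`. [cite: Zhandry2012, Thm. 3.1 (the algorithm's input)] -/
theorem inp_append (x r : List Bool) (hx : P.nOf (x ++ r).length = x.length) :
    P.inp (x ++ r) = fun i => x.get (Fin.cast hx i) := by
  funext i
  have hi : (i : ℕ) < x.length := by rw [← hx]; exact i.2
  simp only [inp, List.get_eq_getElem, Fin.val_cast]
  rw [List.getElem_append_left hi]

/-- **The keyed family on `x ++ r` averages the kernel of `F` at `x` over the keyed slices** (event on the measured
string of `F`, read through `emb`): for `nOf |x ++ r| = |x|`,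
`family.kernelProb A (x ++ r) {s | (i ↦ s[emb i]) spells a string of E} = 2^{-κ} Σ_key F.kernelProb (A⟨r ++ key⟩) x E`.
[cite: Zhandry2012, Thm. 3.1] [cite: BennettBernsteinBrassardVazirani1997, §4] -/
theorem kernelProb_family_append_eq_avg (A : Language Bool) (x r : List Bool) (hx : P.nOf (x ++ r).length = x.length)
    (E : Set (List Bool)) [DecidablePred (· ∈ E)] :
    P.family.kernelProb A (x ++ r)
        {s | List.ofFn (fun i : Fin (P.nOf (x ++ r).length + P.mF (x ++ r).length) =>
          s.getD ((P.emb (x ++ r).length i : Fin ((x ++ r).length + P.anc (x ++ r).length)) : ℕ) false) ∈ E} =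
      (1 / 2 : ℝ) ^ P.κOf (x ++ r).length * ∑ key : QReg (P.κOf (x ++ r).length),
        P.F.kernelProb (prefixSlice A (r ++ List.ofFn key)) x E := by
  classical
  rw [P.kernelProb_family_eq_avg_probEvent A (x ++ r) (fun u => List.ofFn u ∈ E)]
  congr 1
  refine Finset.sum_congr rfl fun key _ => ?_
  have hdrop : (x ++ r).drop (P.nOf (x ++ r).length) = r := by rw [hx, List.drop_left]
  rw [hdrop, inp_append P x r hx]
  exact P.F.probEvent_ofFn_eq_kernelProb _ x hx.symm E

end KeyedRun

end Literature.Computability.QuantumComplexity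

end
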